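/-
Copyright (c) 2026 the pub-hodgecm-mathlib formalisation cell (harness21).  R90-TF SLAB, section S10 (Rogawski 1990, Ch. 13.5–13.8 comparison engine read at `v`),
prover R90-C138-p02 (g0) — DEAL #29 (dealer R90-C138-plan (g3)): brick (P1) of R90-C138-p03 (g2)'s road (R1)″ (F-HEADS `FHEADS-Ma-R1pp.md` §1): «the canonical
Haar measure on a product is the product of the canonical Haar measures»; h413 = `stmt-HodgeConjecture-24833`, route `HCCMUnconditional`.
-/
import Literature.NumberTheory.Automorphic.OrbitalMeasureCanonicalExists        -- ★ `compactCore`, `compactCore_prod` (F0P3a-p08)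
import Literature.NumberTheory.Automorphic.UnitaryGroupOfLocalCovolumeStable     -- ★ `map_eq_of_apply_compactCore_eq_one'` (uniqueness of the canonically normalised Haar measure)
import Literature.MeasureTheory.Group.InvariantQuotientPiTopFactor               -- ★ `isInvInvariant_prod`
import HarnessLib

/-!
# R90-TF ∕ S10 — DEAL #29, brick (P1): the canonical Haar measure on a product of (closed sub)groups is the product of the canonical Haar measures
# (`Theorems/R90S10CanonicalHaarCentraliserProd.lean`; ns `Summit.HodgeConjecture.HodgeConjecture.R90.S10`; generic measure plumbing for p03 (g2)'s F1″)

Cell `hodgecm-mathlib`, crux H413 (`stmt-HodgeConjecture-24833`), route of record `HCCMUnconditional`; programme R90-TF, section S10 (base `R90-C138`).  PROOF lane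
(`--kind proof --supports stmt-HodgeConjecture-24833 --as helper`): four GENERIC theorems (topological groups, no unitary-group token); no `def`, no instance, no
notation, no named fact, no `sorry`; imports ★ only (law L9); default heartbeats.

WHY (p03's road (R1)″ for the (M-a) payer `splitHVanDijkLetter_holds`, F1″ = «canonical class orbital integral on `H_w = U(Φ₂)(L⁺_w) × U(Φ₁)(L⁺_w)` at a regular
split-torus class», SPLIT place).  The orbital measure families of the comparison are CANONICAL (★ `OrbitalMeasureFamily.IsCanonical`): the member at a class is the
invariant quotient `dν ∕ dt` for THE Haar measure `t` on the centraliser normalised by `t(compactCore) = 1` [Rogawski1990, §4.3 (4.3.1) p. 43 «compatible measures on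
`H_{γ′}` and `G_γ`»; §1.7 p. 6].  On `H_w` the centraliser of `(t, u)` is the PRODUCT `Z₂(t) × U(Φ₁)(L⁺_w)` (★ `centralizer_prod_singleton`); at a non-split place the second
factor is compact and ★ FILE 2′ (`UnitaryGroupTorusOrbitalIntegralCanonicalH`) absorbs it into the level, but at a SPLIT place `U(Φ₁)(L⁺_w) ≅ L_W^×` is not compact and
F1″ must read the quotient `(G₂ × U) ⧸ (Z₂ × U) = (G₂ ⧸ Z₂) × pt` through ★ `InvariantQuotientProdNormalized.map_quotientProdHomeomorph_quotientMeasure_prod` — whose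
hypothesis is EXACTLY `hρ : Measure.map (Subgroup.prodEquiv H₁ H₂) ρ = ρ₁.prod ρ₂` for the torus measures.  This file supplies that hypothesis for the CANONICAL
normalisation: the compact core of a product is the product of the compact cores (★ `compactCore_prod`), so the product of two canonically normalised Haar measures
gives the product core mass `1 · 1 = 1` (`prod_apply_compactCore_eq_one`), and by uniqueness of the canonically normalised Haar measure under isomorphisms of
topological groups (★ `map_eq_of_apply_compactCore_eq_one'`, applied to `Subgroup.prodEquiv` made continuous) ANY canonical Haar measure on `H₁ × H₂` maps to
`ρ₁ ⊗ ρ₂` (`map_prodEquiv_eq_prod_of_apply_compactCore_eq_one`); conversely the pulled-back product IS a canonical (Haar, inversion-invariant, core-mass-one) measure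
on `H₁.prod H₂` (`exists_haar_prod_apply_compactCore_eq_one` — the `t_Z` to feed ★ `IsCanonical.classOrbitalIntegral_mk_eq_orbitalIntegral`).
[Folland1995, §2.6 Thm. 2.49 (product Haar measures); Bump1997, §3.3 Prop. 3.3.2; Rogawski1990, §4.3 p. 43]

CONTENTS.  §1 `prod_apply_compactCore_eq_one` · §2 `map_prodEquiv_eq_prod_of_apply_compactCore_eq_one` (uniqueness) · `isHaarMeasure_map_prodEquiv_symm_prod` ·
`exists_haar_prod_apply_compactCore_eq_one` (existence, with the `hρ` clause).  The centraliser spelling is one ★ rewrite away (`centralizer_prod_singleton`).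
HONEST LABEL: a generic brick; pays no socket; HC_CM is proved only modulo the 7 printed citations (2 remaining named inputs: hLiu418 = `stmt-HodgeConjecture-24832`,
h413 = `stmt-HodgeConjecture-24833`) until rung 0 closes; REL ≠ ★ ≠ BUILT; count-neutral.

## References
* [Folland1995] G. B. Folland, *A Course in Abstract Harmonic Analysis* (1995), §2.6 Thm. 2.49, (2.52); §2.2 Thm. 2.20 (uniqueness of Haar measure).
* [Bump1997] D. Bump, *Automorphic Forms and Representations* (1997), §3.3 Prop. 3.3.2.
* [Rogawski1990] J. D. Rogawski, *Automorphic Representations of Unitary Groups in Three Variables*, Ann. of Math. Stud. 123 (1990), §4.3 (4.3.1) p. 43; §1.7 p. 6.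
* [DeitmarEchterhoff2014] A. Deitmar, S. Echterhoff, *Principles of Harmonic Analysis*, 2nd ed. (2014), Thm. 1.5.3.
-/

set_option autoImplicit false
set_option linter.dupNamespace false

noncomputable section

open MeasureTheory Measure Set
open Literature.NumberTheory.Automorphic Literature.MeasureTheory.Group

namespace Summit.HodgeConjecture.HodgeConjecture.R90.S10

/-! ## §1 The product of canonically normalised Haar measures gives the product compact core mass one -/

section Core

variable {Z U : Type*} [Group Z] [Group U] [TopologicalSpace Z] [TopologicalSpace U] [IsTopologicalGroup Z] [IsTopologicalGroup U]
  [MeasurableSpace Z] [MeasurableSpace U]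

/-- **`(t_Z ⊗ t_U)(compactCore (Z × U)) = 1`** for Haar-type measures with `t_Z(compactCore Z) = 1`, `t_U(compactCore U) = 1`: the compact core of a product is the
product of the compact cores (★ `compactCore_prod`) and `(t_Z ⊗ t_U)(A ×ˢ B) = t_Z(A) · t_U(B)` (Mathlib `Measure.prod_prod`).  So the product of the canonically
normalised torus measures IS canonically normalised. [cite: Folland1995, §2.6 Thm. 2.49] [cite: Rogawski1990, §4.3 (4.3.1) p. 43] -/
theorem prod_apply_compactCore_eq_one (tZ : Measure Z) (tU : Measure U) [SFinite tU]
    (hZ : tZ (compactCore Z) = 1) (hU : tU (compactCore U) = 1) : (tZ.prod tU) (compactCore (Z × U)) = 1 := by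
  rw [compactCore_prod, Measure.prod_prod, hZ, hU, one_mul]

end Core

/-! ## §2 On a product of closed subgroups `H₁.prod H₂ ≅ H₁ × H₂`: uniqueness and existence in the currency of ★ `InvariantQuotientProdNormalized` -/

section Continuity

variable {G₁ G₂ : Type*} [Group G₁] [Group G₂] [TopologicalSpace G₁] [TopologicalSpace G₂] (H₁ : Subgroup G₁) (H₂ : Subgroup G₂)

/-- `Subgroup.prodEquiv` is a homeomorphism (both directions are built from coordinate projections and `Subtype.val`); packaged inside proofs only. -/
private theorem continuous_prodEquiv : Continuous (Subgroup.prodEquiv H₁ H₂) :=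
  ((continuous_fst.comp continuous_subtype_val).subtype_mk _).prodMk ((continuous_snd.comp continuous_subtype_val).subtype_mk _)

/-- The inverse of `Subgroup.prodEquiv` is continuous (coordinatewise `Subtype.val`, then `Subtype.mk`). -/
private theorem continuous_prodEquiv_symm : Continuous (Subgroup.prodEquiv H₁ H₂).symm :=
  ((continuous_subtype_val.comp continuous_fst).prodMk (continuous_subtype_val.comp continuous_snd)).subtype_mk _

end Continuity

section ProdSubgroup

variable {G₁ G₂ : Type*} [Group G₁] [Group G₂] [TopologicalSpace G₁] [TopologicalSpace G₂]
  [IsTopologicalGroup G₁] [IsTopologicalGroup G₂] [LocallyCompactSpace G₁] [LocallyCompactSpace G₂]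
  [SecondCountableTopology G₁] [SecondCountableTopology G₂]
  [MeasurableSpace G₁] [BorelSpace G₁] [MeasurableSpace G₂] [BorelSpace G₂]
  (H₁ : Subgroup G₁) (H₂ : Subgroup G₂) [hH₁ : IsClosed (H₁ : Set G₁)] [hH₂ : IsClosed (H₂ : Set G₂)]

/-- **UNIQUENESS: a canonically normalised Haar measure on `H₁.prod H₂` IS the product of the canonically normalised Haar measures of the factors** — read through
Mathlib's `Subgroup.prodEquiv : ↥(H₁.prod H₂) ≃* ↥H₁ × ↥H₂`: `(prodEquiv)_* ρ = ρ₁ ⊗ ρ₂` whenever `ρ`, `ρ₁`, `ρ₂` are Haar measures giving their compact cores mass one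
(`H₁`, `H₂` closed subgroups of second-countable locally compact groups).  This is the hypothesis `hρ` of ★ `map_quotientProdHomeomorph_quotientMeasure_prod` (the
quotient of product Haar measures by `H₁ × H₂` is the product of the quotients) at the CANONICAL normalisation of ★ `OrbitalMeasureFamily.IsCanonical`.  Proof: ★
`map_eq_of_apply_compactCore_eq_one'` for `prodEquiv` as an isomorphism of topological groups, the target mass being `1` by `prod_apply_compactCore_eq_one`.
[cite: Folland1995, §2.6 Thm. 2.49; §2.2 Thm. 2.20] [cite: Bump1997, §3.3 Prop. 3.3.2] [cite: Rogawski1990, §4.3 (4.3.1) p. 43] -/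
theorem map_prodEquiv_eq_prod_of_apply_compactCore_eq_one
    (ρ : Measure ↥(H₁.prod H₂)) [ρ.IsHaarMeasure] (ρ₁ : Measure ↥H₁) [ρ₁.IsHaarMeasure] (ρ₂ : Measure ↥H₂) [ρ₂.IsHaarMeasure]
    (hρ : ρ (compactCore ↥(H₁.prod H₂)) = 1) (h₁ : ρ₁ (compactCore ↥H₁) = 1) (h₂ : ρ₂ (compactCore ↥H₂) = 1) :
    Measure.map (Subgroup.prodEquiv H₁ H₂) ρ = ρ₁.prod ρ₂ := by
  haveI : LocallyCompactSpace ↥H₁ := hH₁.isClosedEmbedding_subtypeVal.locallyCompactSpace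
  haveI : LocallyCompactSpace ↥H₂ := hH₂.isClosedEmbedding_subtypeVal.locallyCompactSpace
  let e : ↥(H₁.prod H₂) ≃ₜ* ↥H₁ × ↥H₂ :=
    { Subgroup.prodEquiv H₁ H₂ with
      continuous_toFun := continuous_prodEquiv H₁ H₂
      continuous_invFun := continuous_prodEquiv_symm H₁ H₂ }
  have he : (⇑e : ↥(H₁.prod H₂) → ↥H₁ × ↥H₂) = ⇑(Subgroup.prodEquiv H₁ H₂) := rfl
  rw [← he]
  exact map_eq_of_apply_compactCore_eq_one' e ρ (ρ₁.prod ρ₂) hρ (prod_apply_compactCore_eq_one ρ₁ ρ₂ h₁ h₂)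

/-- **The pulled-back product of Haar measures is a Haar measure on `H₁.prod H₂`** (Mathlib `ContinuousMulEquiv.isHaarMeasure_map` along `(prodEquiv)⁻¹`; the product
of Haar measures is Haar, `Measure.prod.instIsHaarMeasure`). [cite: Folland1995, §2.6 Thm. 2.49] -/
theorem isHaarMeasure_map_prodEquiv_symm_prod (ρ₁ : Measure ↥H₁) [ρ₁.IsHaarMeasure] (ρ₂ : Measure ↥H₂) [ρ₂.IsHaarMeasure] :
    (Measure.map (Subgroup.prodEquiv H₁ H₂).symm (ρ₁.prod ρ₂)).IsHaarMeasure := by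
  haveI : LocallyCompactSpace ↥H₁ := hH₁.isClosedEmbedding_subtypeVal.locallyCompactSpace
  haveI : LocallyCompactSpace ↥H₂ := hH₂.isClosedEmbedding_subtypeVal.locallyCompactSpace
  let e : ↥(H₁.prod H₂) ≃ₜ* ↥H₁ × ↥H₂ :=
    { Subgroup.prodEquiv H₁ H₂ with
      continuous_toFun := continuous_prodEquiv H₁ H₂
      continuous_invFun := continuous_prodEquiv_symm H₁ H₂ }
  have he : (⇑e.symm : ↥H₁ × ↥H₂ → ↥(H₁.prod H₂)) = ⇑(Subgroup.prodEquiv H₁ H₂).symm := rfl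
  rw [← he]
  exact ContinuousMulEquiv.isHaarMeasure_map (ρ₁.prod ρ₂) e.symm

/-- **EXISTENCE: the canonical torus measure on `H₁.prod H₂` CHOSEN as the pulled-back product** — for canonically normalised, inversion-invariant Haar measures
`ρ₁`, `ρ₂` on closed subgroups `H₁ ≤ G₁`, `H₂ ≤ G₂` there is a Haar measure `ρ` on `H₁.prod H₂` which is inversion invariant, gives the compact core mass one (so it
is admissible as the `t` of ★ `OrbitalMeasureFamily.IsCanonical` ∕ ★ `IsCanonical.classOrbitalIntegral_mk_eq_orbitalIntegral`), and satisfies the product clause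
`(prodEquiv)_* ρ = ρ₁ ⊗ ρ₂` of ★ `map_quotientProdHomeomorph_quotientMeasure_prod`.  (`ρ := (prodEquiv)⁻¹_* (ρ₁ ⊗ ρ₂)`; inversion invariance by ★
`isInvInvariant_prod` and transport; core mass by ★ `image_compactCore` + `prod_apply_compactCore_eq_one`.) [cite: Folland1995, §2.6 Thm. 2.49]
[cite: Rogawski1990, §4.3 (4.3.1) p. 43] [cite: DeitmarEchterhoff2014, Thm. 1.5.3] -/
theorem exists_haar_prod_apply_compactCore_eq_one
    (ρ₁ : Measure ↥H₁) [ρ₁.IsHaarMeasure] [ρ₁.IsInvInvariant] (ρ₂ : Measure ↥H₂) [ρ₂.IsHaarMeasure] [ρ₂.IsInvInvariant]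
    (h₁ : ρ₁ (compactCore ↥H₁) = 1) (h₂ : ρ₂ (compactCore ↥H₂) = 1) :
    ∃ ρ : Measure ↥(H₁.prod H₂), ρ.IsHaarMeasure ∧ ρ.IsInvInvariant ∧ ρ (compactCore ↥(H₁.prod H₂)) = 1 ∧
      Measure.map (Subgroup.prodEquiv H₁ H₂) ρ = ρ₁.prod ρ₂ := by
  haveI : LocallyCompactSpace ↥H₁ := hH₁.isClosedEmbedding_subtypeVal.locallyCompactSpace
  haveI : LocallyCompactSpace ↥H₂ := hH₂.isClosedEmbedding_subtypeVal.locallyCompactSpace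
  let e : ↥(H₁.prod H₂) ≃ₜ* ↥H₁ × ↥H₂ :=
    { Subgroup.prodEquiv H₁ H₂ with
      continuous_toFun := continuous_prodEquiv H₁ H₂
      continuous_invFun := continuous_prodEquiv_symm H₁ H₂ }
  have he : (⇑e : ↥(H₁.prod H₂) → ↥H₁ × ↥H₂) = ⇑(Subgroup.prodEquiv H₁ H₂) := rfl
  have hes : (⇑e.symm : ↥H₁ × ↥H₂ → ↥(H₁.prod H₂)) = ⇑(Subgroup.prodEquiv H₁ H₂).symm := rfl
  haveI hprod : (ρ₁.prod ρ₂).IsInvInvariant := isInvInvariant_prod ρ₁ ρ₂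
  set ρ : Measure ↥(H₁.prod H₂) := Measure.map (Subgroup.prodEquiv H₁ H₂).symm (ρ₁.prod ρ₂) with hρdef
  haveI hρH : ρ.IsHaarMeasure := isHaarMeasure_map_prodEquiv_symm_prod H₁ H₂ ρ₁ ρ₂
  have hme : Measurable (⇑e) := e.continuous.measurable
  have hmes : Measurable (⇑e.symm) := e.symm.continuous.measurable
  -- `e_* ρ = ρ₁ ⊗ ρ₂`
  have hmap : Measure.map (Subgroup.prodEquiv H₁ H₂) ρ = ρ₁.prod ρ₂ := by
    rw [hρdef, ← he, ← hes, Measure.map_map hme hmes]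
    have : (⇑e ∘ ⇑e.symm) = id := funext fun y => e.apply_symm_apply y
    rw [this, Measure.map_id]
  refine ⟨ρ, hρH, ?_, ?_, hmap⟩
  · -- inversion invariance transports along the group isomorphism `e⁻¹`
    refine ⟨?_⟩
    rw [Measure.inv_def, hρdef, ← hes, Measure.map_map measurable_inv hmes]
    have hcomm : (Inv.inv ∘ ⇑e.symm) = (⇑e.symm ∘ Inv.inv) := funext fun y => (map_inv e.symm y).symm
    rw [hcomm, ← Measure.map_map hmes measurable_inv, Measure.map_inv_eq_self]
  · -- core mass one: `ρ(core) = (ρ₁ ⊗ ρ₂)(e '' core) = (ρ₁ ⊗ ρ₂)(core) = 1`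
    have hco : (⇑e.symm : ↥H₁ × ↥H₂ → ↥(H₁.prod H₂)) = ⇑(e.symm.toHomeomorph.toMeasurableEquiv) := rfl
    have hpre : ⇑e.symm ⁻¹' compactCore ↥(H₁.prod H₂) = compactCore (↥H₁ × ↥H₂) := by
      rw [← image_compactCore e.symm]; exact e.symm.injective.preimage_image _
    rw [hρdef, ← hes, hco, MeasurableEquiv.map_apply, ← hco, hpre]
    exact prod_apply_compactCore_eq_one ρ₁ ρ₂ h₁ h₂

end ProdSubgroup

end Summit.HodgeConjecture.HodgeConjecture.R90.S10

end
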